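import Summits.CriticalPhenomena.PercolationContinuityZ3.Theorems.Transplant.FKConnectivityAllQAntipodalTwoSpinePeel
import HarnessLib

/-!
# Two-spine word model of `U¹¹` — peeling a DIAGRAM STATEMENT (the induction step of the mode induction)

Theorem file (`--supports stmt-CriticalPhenomena-4575`), FK sub-lane `prim-bschramm-fk-2` (gen 15); builds on p205010 (kernel
theorem, internal audit signed; external expert review pending).  No named facts, no sorries.

`FK.TwoSpine.Diagram.peelA k D` replaces every node `(m, e)` of `D` by the four nodes `(peelA m k b b̄)` (`(b, b̄) ∈ {0,1}²`, in the
order `00, 01, 10, 11`, node `i` becoming nodes `4i … 4i+3`), keeps the order constraints letter by letter and ADDS `4i+1 ≤ 4i+2`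
(`S_i(u·01, v) ≤ S_i(u·10, v)`).  Then `dsum D (oA ++ [k]) oB S = dsum (peelA k D) oA oB S⁺` for the re-indexed family
`S⁺ n u v = S (n/4) (u ++ [ℓ_{n%4}]) v` (`FK.TwoSpine.dsum_peelA`), `S⁺` is admissible for the peeled diagram when `S` is for `D`
(`FK.TwoSpine.Admissible.peelA` — the added constraint is flip-monotonicity), hence
**`FK.TwoSpine.DStmt.of_peelA`**: `DStmt (peelA k D) oA oB → DStmt D (oA ++ [k]) oB`; likewise `…of_peelB` for the `B`-spine.
[cite: Grimmett2006, §3.8 (pp. 61–62)]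
-/

noncomputable section

namespace Summit.CriticalPhenomena.PercolationContinuityZ3.Theorems

namespace FK

namespace TwoSpine

open X2Word

/-! ### Letters by index, peeled diagrams, re-indexed families -/

/-- The four bit pairs of a letter, indexed `0 ↦ 00, 1 ↦ 01, 2 ↦ 10, 3 ↦ 11` (index mod 4). [folklore] -/
def bitsOf (r : ℕ) : Bool × Bool := (decide (2 ≤ r % 4), decide (r % 2 = 1))

/-- `bitsOf` table. [folklore] -/
@[simp] theorem bitsOf_zero : bitsOf 0 = (false, false) := by decide
/-- `bitsOf` table. [folklore] -/
@[simp] theorem bitsOf_one : bitsOf 1 = (false, true) := by decide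
/-- `bitsOf` table. [folklore] -/
@[simp] theorem bitsOf_two : bitsOf 2 = (true, false) := by decide
/-- `bitsOf` table. [folklore] -/
@[simp] theorem bitsOf_three : bitsOf 3 = (true, true) := by decide
/-- `bitsOf` only reads the index mod 4. [folklore] -/
theorem bitsOf_add_four_mul (i r : ℕ) : bitsOf (4 * i + r) = bitsOf r := by
  unfold bitsOf
  have h1 : (4 * i + r) % 4 = r % 4 := by omega
  have h2 : (4 * i + r) % 2 = r % 2 := by omega
  rw [h1, h2]

/-- The default node used by `dsum` for out-of-range indices. [folklore] -/
def dfltNode : Modes × ℕ := ((.o, .o, .o, .o), 0)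

/-- The four peeled copies of a node for the outermost `A`-letter of kind `k`, in the order `00, 01, 10, 11`. [folklore] -/
def peelNodeA (k : Kind) (nd : Modes × ℕ) : List (Modes × ℕ) :=
  (List.range 4).map fun r => ((peelA nd.1 k (bitsOf r).1 (bitsOf r).2).1, nd.2 + (peelA nd.1 k (bitsOf r).1 (bitsOf r).2).2)

/-- The four peeled copies of a node for the outermost `B`-letter of kind `k`. [folklore] -/
def peelNodeB (k : Kind) (nd : Modes × ℕ) : List (Modes × ℕ) :=
  (List.range 4).map fun r => ((peelB nd.1 k (bitsOf r).1 (bitsOf r).2).1, nd.2 + (peelB nd.1 k (bitsOf r).1 (bitsOf r).2).2)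

/-- **The peeled diagram (outermost `A`-part of kind `k`)**: node `i` becomes nodes `4i, …, 4i+3`; the order constraints are kept
letter by letter and `4i+1 ≤ 4i+2` is added for every `i` (memo g15 §6). [folklore] -/
def Diagram.peelA (k : Kind) (D : Diagram) : Diagram where
  nodes := D.nodes.flatMap (peelNodeA k)
  le := (D.le.flatMap fun p => (List.range 4).map fun r => (4 * p.1 + r, 4 * p.2 + r)) ++
    (List.range D.nodes.length).map fun i => (4 * i + 1, 4 * i + 2)

/-- **The peeled diagram (outermost `B`-part of kind `k`)**. [folklore] -/
def Diagram.peelB (k : Kind) (D : Diagram) : Diagram where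
  nodes := D.nodes.flatMap (peelNodeB k)
  le := (D.le.flatMap fun p => (List.range 4).map fun r => (4 * p.1 + r, 4 * p.2 + r)) ++
    (List.range D.nodes.length).map fun i => (4 * i + 1, 4 * i + 2)

/-- The re-indexed family for `A`-peeling: node `n` reads node `n / 4` of the old family on the word extended by the letter `n % 4`. [folklore] -/
def famPeelA (k : Kind) (S : ℕ → List SLetter → List SLetter → ℝ) : ℕ → List SLetter → List SLetter → ℝ :=
  fun n u v => S (n / 4) (u ++ [(k, (bitsOf n).1, (bitsOf n).2)]) v

/-- The re-indexed family for `B`-peeling. [folklore] -/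
def famPeelB (k : Kind) (S : ℕ → List SLetter → List SLetter → ℝ) : ℕ → List SLetter → List SLetter → ℝ :=
  fun n u v => S (n / 4) u (v ++ [(k, (bitsOf n).1, (bitsOf n).2)])

/-! ### Bookkeeping lemmas -/

/-- Length of the peeled node list. [folklore] -/
theorem length_peelA_nodes (k : Kind) (D : Diagram) : (D.peelA k).nodes.length = 4 * D.nodes.length := by
  unfold Diagram.peelA
  induction D.nodes with
  | nil => rfl
  | cons nd l ih => simp [List.flatMap_cons, peelNodeA] at ih ⊢; omega

/-- Length of the peeled node list (`B`). [folklore] -/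
theorem length_peelB_nodes (k : Kind) (D : Diagram) : (D.peelB k).nodes.length = 4 * D.nodes.length := by
  unfold Diagram.peelB
  induction D.nodes with
  | nil => rfl
  | cons nd l ih => simp [List.flatMap_cons, peelNodeB] at ih ⊢; omega

/-- The node `4i + r` of a flat-mapped list of 4-blocks. [folklore] -/
theorem getD_flatMap_four {α : Type*} (f : Modes × ℕ → List α) (hf : ∀ nd, (f nd).length = 4) (l : List (Modes × ℕ))
    (d : α) (dn : Modes × ℕ) (i r : ℕ) (hi : i < l.length) (hr : r < 4) :
    (l.flatMap f).getD (4 * i + r) d = (f (l.getD i dn)).getD r d := by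
  induction l generalizing i with
  | nil => simp at hi
  | cons nd l ih =>
    rw [List.flatMap_cons]
    cases i with
    | zero =>
      rw [Nat.mul_zero, Nat.zero_add, List.getD_cons_zero, List.getD_eq_getElem?_getD, List.getElem?_append_left (by rw [hf]; exact hr),
        ← List.getD_eq_getElem?_getD]
    | succ i =>
      have hlen : (f nd).length ≤ 4 * (i + 1) + r := by rw [hf]; omega
      rw [List.getD_eq_getElem?_getD, List.getElem?_append_right hlen, hf, ← List.getD_eq_getElem?_getD,
        show 4 * (i + 1) + r - 4 = 4 * i + r by omega, ih i (by simpa using hi), List.getD_cons_succ]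

/-- The peeled node `4i + r` (`A`). [folklore] -/
theorem peelA_node (k : Kind) (D : Diagram) (i r : ℕ) (hi : i < D.nodes.length) (hr : r < 4) :
    (D.peelA k).nodes.getD (4 * i + r) dfltNode =
      ((peelA (D.nodes.getD i dfltNode).1 k (bitsOf r).1 (bitsOf r).2).1,
        (D.nodes.getD i dfltNode).2 + (peelA (D.nodes.getD i dfltNode).1 k (bitsOf r).1 (bitsOf r).2).2) := by
  unfold Diagram.peelA
  rw [getD_flatMap_four (peelNodeA k) (fun _ => by simp [peelNodeA]) D.nodes dfltNode dfltNode i r hi hr]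
  unfold peelNodeA
  rw [List.getD_eq_getElem?_getD, List.getElem?_map, List.getElem?_range hr]
  rfl

/-- The peeled node `4i + r` (`B`). [folklore] -/
theorem peelB_node (k : Kind) (D : Diagram) (i r : ℕ) (hi : i < D.nodes.length) (hr : r < 4) :
    (D.peelB k).nodes.getD (4 * i + r) dfltNode =
      ((peelB (D.nodes.getD i dfltNode).1 k (bitsOf r).1 (bitsOf r).2).1,
        (D.nodes.getD i dfltNode).2 + (peelB (D.nodes.getD i dfltNode).1 k (bitsOf r).1 (bitsOf r).2).2) := by
  unfold Diagram.peelB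
  rw [getD_flatMap_four (peelNodeB k) (fun _ => by simp [peelNodeB]) D.nodes dfltNode dfltNode i r hi hr]
  unfold peelNodeB
  rw [List.getD_eq_getElem?_getD, List.getElem?_map, List.getElem?_range hr]
  rfl

/-- Summing over `range (4L)` in blocks of four. [folklore] -/
theorem sum_range_four_mul (L : ℕ) (F : ℕ → ℝ) :
    ∑ n ∈ Finset.range (4 * L), F n = ∑ i ∈ Finset.range L, ∑ r ∈ Finset.range 4, F (4 * i + r) := by
  induction L with
  | zero => simp
  | succ L ih =>
    rw [show 4 * (L + 1) = 4 * L + 1 + 1 + 1 + 1 by ring, Finset.sum_range_succ, Finset.sum_range_succ, Finset.sum_range_succ,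
      Finset.sum_range_succ, ih, Finset.sum_range_succ]
    simp only [Finset.sum_range_succ, Finset.range_zero, Finset.sum_empty, zero_add]
    ring_nf

/-- Membership in `kindWords o`: exactly the σ-words whose kind sequence is `o`. [folklore] -/
theorem mem_kindWords {o : List Kind} {w : List SLetter} : w ∈ kindWords o ↔ w.map (·.1) = o := by
  induction o generalizing w with
  | nil => simp [kindWords, List.map_eq_nil_iff]
  | cons k o ih =>
    simp only [kindWords, Finset.mem_image, Finset.mem_product, Finset.mem_univ, true_and, Prod.exists]
    constructor
    · rintro ⟨b, bb, u, hu, rfl⟩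
      rw [List.map_cons, ih.1 hu]
    · intro h
      cases w with
      | nil => simp at h
      | cons l u =>
        rw [List.map_cons, List.cons.injEq] at h
        refine ⟨l.2.1, l.2.2, u, ih.2 h.2, ?_⟩
        rcases l with ⟨k', b', bb'⟩
        simp only at h
        rw [h.1]

/-- Words of a shape with one more outermost position: append a letter of that kind with free bits. [folklore] -/
theorem kindWords_snoc (o : List Kind) (k : Kind) :
    kindWords (o ++ [k]) = ((kindWords o) ×ˢ (Finset.univ : Finset (Bool × Bool))).image fun p => p.1 ++ [(k, p.2.1, p.2.2)] := by
  ext w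
  simp only [mem_kindWords, Finset.mem_image, Finset.mem_product, Finset.mem_univ, and_true, Prod.exists]
  constructor
  · intro h
    obtain ⟨l₁, l₂, rfl, h₁, h₂⟩ := List.map_eq_append_iff.1 h
    obtain ⟨x, l₃, rfl, hx, h₃⟩ := List.map_eq_cons_iff.1 h₂
    rw [List.map_eq_nil_iff] at h₃
    subst h₃
    refine ⟨l₁, x.2.1, x.2.2, h₁, ?_⟩
    rcases x with ⟨k', b', bb'⟩
    simp only at hx
    rw [hx]
  · rintro ⟨u, b, bb, hu, rfl⟩
    rw [List.map_append, hu, List.map_singleton]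

/-- Summation over the words of `o ++ [k]` = summation over the words of `o` and the four outermost letters. [folklore] -/
theorem sum_kindWords_snoc (o : List Kind) (k : Kind) (F : List SLetter → ℝ) :
    ∑ u ∈ kindWords (o ++ [k]), F u = ∑ u ∈ kindWords o, ∑ r ∈ Finset.range 4, F (u ++ [(k, (bitsOf r).1, (bitsOf r).2)]) := by
  rw [kindWords_snoc, Finset.sum_image]
  · rw [Finset.sum_product]
    refine Finset.sum_congr rfl fun u _ => ?_
    -- the four bit pairs
    have : (Finset.univ : Finset (Bool × Bool)) = {(false, false), (false, true), (true, false), (true, true)} := by decide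
    rw [this]
    simp [Finset.sum_range_succ, Finset.sum_insert]
    ring
  · rintro ⟨u, b⟩ _ ⟨u', b'⟩ _ h
    simp only at h
    obtain ⟨hu, hl⟩ := List.append_inj' h rfl
    simp only [List.cons.injEq, Prod.mk.injEq, and_true, true_and] at hl
    ext <;> simp [hu, hl.1, hl.2]

/-! ### Peeling the diagram sum and the admissibility of the re-indexed family -/

/-- `dsum` written with the named default node. [folklore] -/
theorem dsum_eq (q : ℝ) (top : Top) (D : Diagram) (oA oB : List Kind) (S : ℕ → List SLetter → List SLetter → ℝ) :
    dsum q top D oA oB S = ∑ i ∈ Finset.range D.nodes.length, q ^ (D.nodes.getD i dfltNode).2 *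
      ∑ u ∈ kindWords oA, ∑ v ∈ kindWords oB, theta q top (D.nodes.getD i dfltNode).1 u v * S i u v := rfl


/-- **Peeling the outermost `A`-part in a diagram sum**: `dsum D (oA ++ [k]) oB S = dsum (peelA k D) oA oB S⁺`. [folklore] -/
theorem dsum_peelA (q : ℝ) (top : Top) (D : Diagram) (oA oB : List Kind) (k : Kind) (S : ℕ → List SLetter → List SLetter → ℝ) :
    dsum q top D (oA ++ [k]) oB S = dsum q top (D.peelA k) oA oB (famPeelA k S) := by
  rw [dsum_eq, dsum_eq, length_peelA_nodes, sum_range_four_mul]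
  refine Finset.sum_congr rfl fun i hi => ?_
  rw [Finset.mem_range] at hi
  have hswap : ∀ F : List SLetter → List SLetter → ℝ, ∑ u ∈ kindWords (oA ++ [k]), ∑ v ∈ kindWords oB, F u v =
      ∑ r ∈ Finset.range 4, ∑ u ∈ kindWords oA, ∑ v ∈ kindWords oB, F (u ++ [(k, (bitsOf r).1, (bitsOf r).2)]) v := by
    intro F
    rw [sum_kindWords_snoc, Finset.sum_comm]
  rw [hswap, Finset.mul_sum]
  refine Finset.sum_congr rfl fun r hr => ?_
  rw [Finset.mem_range] at hr
  rw [peelA_node k D i r hi hr, Finset.mul_sum, Finset.mul_sum]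
  refine Finset.sum_congr rfl fun u _ => ?_
  rw [Finset.mul_sum, Finset.mul_sum]
  refine Finset.sum_congr rfl fun v _ => ?_
  have hdiv : (4 * i + r) / 4 = i := by omega
  simp only [famPeelA, hdiv, bitsOf_add_four_mul, theta_append_A, pow_add]
  ring

/-- **Peeling the outermost `B`-part in a diagram sum**. [folklore] -/
theorem dsum_peelB (q : ℝ) (top : Top) (D : Diagram) (oA oB : List Kind) (k : Kind) (S : ℕ → List SLetter → List SLetter → ℝ) :
    dsum q top D oA (oB ++ [k]) S = dsum q top (D.peelB k) oA oB (famPeelB k S) := by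
  rw [dsum_eq, dsum_eq, length_peelB_nodes, sum_range_four_mul]
  refine Finset.sum_congr rfl fun i hi => ?_
  rw [Finset.mem_range] at hi
  have hswap : ∀ F : List SLetter → List SLetter → ℝ, ∑ u ∈ kindWords oA, ∑ v ∈ kindWords (oB ++ [k]), F u v =
      ∑ r ∈ Finset.range 4, ∑ u ∈ kindWords oA, ∑ v ∈ kindWords oB, F u (v ++ [(k, (bitsOf r).1, (bitsOf r).2)]) := by
    intro F
    calc ∑ u ∈ kindWords oA, ∑ v ∈ kindWords (oB ++ [k]), F u v
        = ∑ u ∈ kindWords oA, ∑ v ∈ kindWords oB, ∑ r ∈ Finset.range 4, F u (v ++ [(k, (bitsOf r).1, (bitsOf r).2)]) :=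
          Finset.sum_congr rfl fun u _ => sum_kindWords_snoc oB k (F u)
      _ = ∑ u ∈ kindWords oA, ∑ r ∈ Finset.range 4, ∑ v ∈ kindWords oB, F u (v ++ [(k, (bitsOf r).1, (bitsOf r).2)]) :=
          Finset.sum_congr rfl fun u _ => Finset.sum_comm
      _ = _ := Finset.sum_comm
  rw [hswap, Finset.mul_sum]
  refine Finset.sum_congr rfl fun r hr => ?_
  rw [Finset.mem_range] at hr
  rw [peelB_node k D i r hi hr, Finset.mul_sum, Finset.mul_sum]
  refine Finset.sum_congr rfl fun u _ => ?_
  rw [Finset.mul_sum, Finset.mul_sum]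
  refine Finset.sum_congr rfl fun v _ => ?_
  have hdiv : (4 * i + r) / 4 = i := by omega
  simp only [famPeelB, hdiv, bitsOf_add_four_mul, theta_append_B, pow_add]
  ring

/-- An up-flip survives appending the same suffix to both words. [folklore] -/
theorem UpFlip.append {u u' : List SLetter} (h : UpFlip u u') (w : List SLetter) : UpFlip (u ++ w) (u' ++ w) := by
  obtain ⟨pre, suf, k, rfl, rfl⟩ := h
  exact ⟨pre, suf ++ w, k, by simp, by simp⟩

/-- The single flip `u·01 → u·10` of the outermost letter. [folklore] -/
theorem UpFlip.snoc (u : List SLetter) (k : Kind) : UpFlip (u ++ [(k, false, true)]) (u ++ [(k, true, false)]) :=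
  ⟨u, [], k, rfl, rfl⟩

/-- **The re-indexed family is admissible for the peeled diagram** (the added constraints `4i+1 ≤ 4i+2` are flip-monotonicity of
the old family in the outermost letter — Theorem U for the peeled part, at the level of configurations). [folklore] -/
theorem Admissible.peelA {D : Diagram} {S : ℕ → List SLetter → List SLetter → ℝ} (hS : Admissible D S) (k : Kind) :
    Admissible (D.peelA k) (famPeelA k S) where
  nonneg _ _ _ := hS.nonneg _ _ _
  monoA _ _ _ _ h := hS.monoA _ _ _ _ (h.append _)
  monoB _ _ _ _ h := hS.monoB _ _ _ _ h
  le p hp u v := by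
    unfold Diagram.peelA at hp
    simp only [List.mem_append, List.mem_flatMap, List.mem_map, List.mem_range] at hp
    rcases hp with ⟨⟨i, j⟩, hij, r, hr, rfl⟩ | ⟨i, -, rfl⟩
    · have h1 : (4 * i + r) / 4 = i := by omega
      have h2 : (4 * j + r) / 4 = j := by omega
      simp only [famPeelA, h1, h2, bitsOf_add_four_mul]
      exact hS.le (i, j) hij _ _
    · have h1 : (4 * i + 1) / 4 = i := by omega
      have h2 : (4 * i + 2) / 4 = i := by omega
      simp only [famPeelA, h1, h2, bitsOf_add_four_mul, bitsOf_one, bitsOf_two]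
      exact hS.monoA _ _ _ _ (UpFlip.snoc u k)

/-- **The re-indexed family is admissible for the peeled diagram** (`B`). [folklore] -/
theorem Admissible.peelB {D : Diagram} {S : ℕ → List SLetter → List SLetter → ℝ} (hS : Admissible D S) (k : Kind) :
    Admissible (D.peelB k) (famPeelB k S) where
  nonneg _ _ _ := hS.nonneg _ _ _
  monoA _ _ _ _ h := hS.monoA _ _ _ _ h
  monoB _ _ _ _ h := hS.monoB _ _ _ _ (h.append _)
  le p hp u v := by
    unfold Diagram.peelB at hp
    simp only [List.mem_append, List.mem_flatMap, List.mem_map, List.mem_range] at hp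
    rcases hp with ⟨⟨i, j⟩, hij, r, hr, rfl⟩ | ⟨i, -, rfl⟩
    · have h1 : (4 * i + r) / 4 = i := by omega
      have h2 : (4 * j + r) / 4 = j := by omega
      simp only [famPeelB, h1, h2, bitsOf_add_four_mul]
      exact hS.le (i, j) hij _ _
    · have h1 : (4 * i + 1) / 4 = i := by omega
      have h2 : (4 * i + 2) / 4 = i := by omega
      simp only [famPeelB, h1, h2, bitsOf_add_four_mul, bitsOf_one, bitsOf_two]
      exact hS.monoB _ _ _ _ (UpFlip.snoc v k)

/-- **INDUCTION STEP of the mode induction (`A`-spine)**: the statement of the peeled diagram for the shapes `(oA, oB)` implies the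
statement of the diagram for `(oA ++ [k], oB)` (memo g15 §6). [folklore] -/
theorem DStmt.of_peelA {q : ℝ} {top : Top} {D : Diagram} {oA oB : List Kind} {k : Kind}
    (h : DStmt q top (D.peelA k) oA oB) : DStmt q top D (oA ++ [k]) oB := by
  intro S hS
  rw [dsum_peelA]
  exact h _ (hS.peelA k)

/-- **INDUCTION STEP of the mode induction (`B`-spine)**. [folklore] -/
theorem DStmt.of_peelB {q : ℝ} {top : Top} {D : Diagram} {oA oB : List Kind} {k : Kind}
    (h : DStmt q top (D.peelB k) oA oB) : DStmt q top D oA (oB ++ [k]) := by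
  intro S hS
  rw [dsum_peelB]
  exact h _ (hS.peelB k)

end TwoSpine

end FK

end Summit.CriticalPhenomena.PercolationContinuityZ3.Theorems

end
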